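import Literature.RepresentationTheory.HarrisKudlaSweet1996.SplittingCharactersCM
import Literature.NumberTheory.Automorphic.UnitaryGroupArchimedeanPlaces
import HarnessLib

/-!
# Archimedean components of a global splitting character `χ|_{𝕀_{L⁺}} = ε_{L/L⁺}` of a CM field,
# and the `det`-power twist of `U(J)(L ⊗ ℝ)` they define
([HarrisKudlaSweet1996, §1 (1.5)]: `χ_V|_{F^×} = ε^m_{E/F}`, read at the ARCHIMEDEAN places of `F = L⁺`)

Topic `NumberTheory/GelbartRogawski1991`; namespace
`Literature.NumberTheory.GelbartRogawski1991.UnitaryDualPair.ArchSplitting` (companion of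
`CMSplittingCharLocalComponents`, which treats the FINITE places). KERNEL only: proved theorems; no new notion, no
named fact, no `sorry`.

For a CM field `L` (maximal totally real subfield `L⁺`, complex conjugation `c`), a UNITARY Hecke character `χ` of `L`
with `χ|_{𝕀_{L⁺}} = ε_{L/L⁺}` (`IsSplittingChar L 1 χ`) has at every (complex) place `w` the component
`χ_w(z) = (z/|z|)^{e_w}` with `e_w` ODD — in tree vocabulary: `χ.HasUnitaryArchType e 0` with `e_w ≡ 1 (mod 2)`,
the tree's kernel theorem `IsSplittingChar.exists_hasUnitaryArchType` ([Liu2021, Remark 4.2]: the weight `𝔴_μ` of a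
conjugate-symplectic character is odd).  This file turns that classification into the elementary identity used at the
archimedean places by the kernel construction of [GelbartRogawski1991, Prop. 3.1.1] (compatible splitting of the
metaplectic cover over `U(J)(𝔸)`, stage-1 cell `pub-hodgecm`, seat GR-3, input `stub_S1arch_twist`):

* § 1 (private helpers) `χ_w(z)² = (z/z̄)^{e_w}` (from the tree's `CMQuadraticExtension.archUnitaryValue_zero_right`,
  `div_norm_sq_eq_div_conj`), `(u^k)² u⁻¹ = u^{2k−1}`, `2·((e+1)/2) − 1 = e` for odd `e`;
* § 2 for `wOf : {v ∣ ∞ real place of L⁺} → {w complex place of L}` with `wOf v ∣ v` (the binders `wOf, hover` of the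
  tree's archimedean Weil files, e.g. `cmPlaceOver L`): `v ↦ wOf v` is a BIJECTION onto the infinite places of `L`
  (`wOf_val_bijective`; `L⁺` totally real, `L/L⁺` CM: Mathlib `IsCMField.equivInfinitePlace`), hence
  `prod_infinitePlace_eq_prod_wOf` (`∏_{w ∣ ∞} f w = ∏_v f (wOf v)`);
* § 3 `exists_archDetZPow` — for integers `k_v` the continuous character
  `η_k : U(J)(E ⊗ ℝ) → ℂˣ, g ↦ ∏_v det(g_{wOf v})^{k_v}` (`g_w = archAt w g ∈ U(σ_w J)(ℂ)`), any `E/F`, `c`, `N`, `J`;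
* § 4 **`IsSplittingChar.exists_archDetTwist`** — for `χ` unitary with `χ|_{𝕀_{L⁺}} = ε` there are an odd tuple
  `e` with `χ.HasUnitaryArchType e 0` and the character `η = η_k`, `k_v = (e_{wOf v} + 1)/2`, such that for every
  `g ∈ U(J)(L ⊗ ℝ)` and every infinite idele `x = (x_w)_w` of `L` with `σ_w(x_w)/σ_w(x_w)‾ = det g_w` (`w = wOf v`):
  `η(g)² · ∏_v det(g_{wOf v})⁻¹ = χ((x, 1))²`.
  (On the Siegel parabolic of the doubled unitary group, `x_w = det` of the Levi block and `det g_w = x_w/x̄_w`; the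
  factor `∏_v det(g_{wOf v})⁻¹` is the quotient character of Folland's `det^{1/2}`-normalised metaplectic section —
  those two identifications are the consumer's, not this file's.)

Nothing in this file is a claim of the manuscripts adjudicated by the Hodge-CM cells.

## References

* M. Harris, S. S. Kudla, W. J. Sweet, *Theta dichotomy for unitary groups*, J. Amer. Math. Soc. 9 (1996), §1 (1.5)
  p. 951 [HarrisKudlaSweet1996].
* Y. Liu, *Fourier–Jacobi cycles and arithmetic relative trace formula*, Camb. J. Math. 9 (2021), §4.1 Remark 4.2
  [Liu2021].
* S. Gelbart, J. Rogawski, *L-functions and Fourier–Jacobi coefficients for the unitary group U(3)*, Invent. Math.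
  105 (1991), §3.1 Prop. 3.1.1 p. 455, Remark p. 457 [GelbartRogawski1991].
* A. Borel, H. Jacquet, *Automorphic forms and automorphic representations*, PSPM 33.1 (1979), §4.1 (the archimedean
  component group `G(F ⊗ ℝ) = ∏_{v∣∞} G(F_v)`) [BorelJacquet1979].
* A. Paul, *Howe correspondence for real unitary groups*, J. Funct. Anal. 159 (1998), §1.2 (1.2.1)–(1.2.2) p. 389
  (the `det^{m/2}`-covers of `U(p,q)` and their `det`-power characters) [Paul1998].
* S. Patrikis, *Variations on a theorem of Tate*, Mem. AMS 258 (2019), §2.1 (archimedean parameters of unitary Hecke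
  characters) [Patrikis2019].
* J. S. Milne, *Complex Multiplication* (course notes, 2006), Ch. I Prop. 1.4 (CM fields = totally imaginary quadratic
  extensions of totally real fields) [MilneCM2006].
-/

set_option autoImplicit false

noncomputable section

open NumberField NumberField.InfinitePlace
open scoped ComplexConjugate MatrixGroups Classical

open _root_.Literature.NumberTheory.Automorphic _root_.Literature.NumberTheory.Automorphic.UnitaryGroup
open _root_.Literature.NumberTheory.GaloisRepresentations
open _root_.Literature.NumberTheory.GaloisRepresentations.HeckeCharacter.CMQuadraticExtension
  (archUnitaryValue_zero_right div_norm_sq_eq_div_conj)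
open _root_.Literature.RepresentationTheory.HarrisKudlaSweet1996

namespace Literature.NumberTheory.GelbartRogawski1991.UnitaryDualPair.ArchSplitting

/-! ## § 1 One complex place: `(z/|z|)^m`, its square, odd powers -/

section Local

/-- `χ_w(z)² = (z/z̄)^{e}`: the square of the unitary value `(z/|z|)^e` is `(z/z̄)^e` (`z ≠ 0`; tree
`CMQuadraticExtension.archUnitaryValue_zero_right`, `div_norm_sq_eq_div_conj`). [folklore] -/
private theorem archUnitaryValue_zero_right_sq (m : ℤ) {z : ℂ} (hz : z ≠ 0) :
    archUnitaryValue m 0 z ^ 2 = (z / conj z) ^ m := by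
  rw [archUnitaryValue_zero_right, ← zpow_natCast, ← zpow_mul, mul_comm, zpow_mul, zpow_natCast,
    div_norm_sq_eq_div_conj hz]

/-- `(u^k)² · u⁻¹ = u^{2k−1}` for `u ≠ 0`. [folklore] -/
private theorem zpow_sq_mul_inv {u : ℂ} (hu : u ≠ 0) (k : ℤ) : (u ^ k) ^ 2 * u⁻¹ = u ^ (2 * k - 1) := by
  rw [zpow_sub_one₀ hu, two_mul, zpow_add₀ hu, sq]

/-- An odd integer `e` is `2k − 1` with `k = (e + 1)/2`. [folklore] -/
private theorem two_mul_add_one_ediv_two_sub_one {e : ℤ} (he : Odd e) : 2 * ((e + 1) / 2) - 1 = e := by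
  obtain ⟨m, rfl⟩ := he
  omega

end Local

/-! ## § 2 Places of a CM field over the real places of `L⁺` -/

section Places

variable (L : Type) [Field L] [NumberField L] [IsCMField L]

variable (wOf : {v : InfinitePlace (maximalRealSubfield L) // v.IsReal} → {w : InfinitePlace L // w.IsComplex})
  (hover : ∀ v, (wOf v).1.comap (algebraMap (maximalRealSubfield L) L) = v.1)

include hover in
/-- **A choice `v ↦ wOf v` of a place of the CM field `L` over each real place `v` of `L⁺` is a bijection onto the
infinite places of `L`** — a CM field is a totally imaginary quadratic extension of its totally real subfield
`L⁺`, so over each (real) place of `L⁺` lies exactly one (complex) place of `L` [MilneCM2006, Ch. I Prop. 1.4 (a)⇔(b)]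
(Mathlib: `IsCMField.equivInfinitePlace`, `IsTotallyReal (maximalRealSubfield L)`). [cite: MilneCM2006, Ch. I Prop. 1.4] -/
theorem wOf_val_bijective : Function.Bijective fun v : {v : InfinitePlace (maximalRealSubfield L) // v.IsReal} => (wOf v).1 := by
  constructor
  · intro v v' h
    apply Subtype.ext
    have h1 : (wOf v).1 = (wOf v').1 := h
    have h' : (wOf v).1.comap (algebraMap (maximalRealSubfield L) L) =
        (wOf v').1.comap (algebraMap (maximalRealSubfield L) L) := by rw [h1]
    exact (hover v).symm.trans (h'.trans (hover v'))
  · intro w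
    refine ⟨⟨w.comap (algebraMap (maximalRealSubfield L) L), IsTotallyReal.isReal _⟩, ?_⟩
    apply (IsCMField.equivInfinitePlace L).injective
    rw [IsCMField.equivInfinitePlace_apply, IsCMField.equivInfinitePlace_apply, hover]

include hover in
/-- Reindexing a product over the infinite places of the CM field `L` by the real places of `L⁺` along the
bijection `v ↦ wOf v` of [MilneCM2006, Ch. I Prop. 1.4]: `∏_{w ∣ ∞} f w = ∏_v f (wOf v)`.
[cite: MilneCM2006, Ch. I Prop. 1.4] -/
theorem prod_infinitePlace_eq_prod_wOf {M : Type*} [CommMonoid M] (f : InfinitePlace L → M) :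
    ∏ w : InfinitePlace L, f w = ∏ v : {v : InfinitePlace (maximalRealSubfield L) // v.IsReal}, f (wOf v).1 :=
  (Fintype.prod_equiv (Equiv.ofBijective _ (wOf_val_bijective L wOf hover)) (fun v => f (wOf v).1) f
    fun _ => rfl).symm

end Places

/-! ## § 3 The `det`-power characters of `U(J)(E ⊗ ℝ)` -/

section DetPow

variable (F E : Type) [Field F] [NumberField F] [Field E] [NumberField E] [Algebra F E]
  (c : E ≃ₐ[F] E) (N : ℕ) (J : Matrix (Fin N) (Fin N) E) (hc : c ≠ 1)
  (wOf : {v : InfinitePlace F // v.IsReal} → {w : InfinitePlace E // w.IsComplex})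
  (hw : ∀ v, c • (wOf v).1 = (wOf v).1)

omit [NumberField E] in
/-- **The `det`-power character `η_k(g) = ∏_v det(g_{wOf v})^{k_v}` of `U(J)(E ⊗ ℝ)`** (`g_w = archAt w g ∈ U(σ_w J)(ℂ)`,
integers `k_v`): a continuous homomorphism `U(J)(E ⊗ ℝ) → ℂˣ` — the INTEGER powers of `det` on the real unitary
groups `U(σ_w J)(ℂ) ≅ U(p,q)`, i.e. the characters of [Paul1998, §1.2 (1.2.2) p. 389] that are trivial on the kernel
of the `det^{1/2}`-cover, composed with the place components `archAt w : U(J)(E ⊗ ℝ) → U(σ_w J)(ℂ)` of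
`G(F ⊗ ℝ) = ∏_{v∣∞} G(F_v)` [BorelJacquet1979, §4.1] (continuous homomorphisms; `det` and integer powers are
continuous on `GL_N(ℂ)`). [cite: Paul1998, §1.2 (1.2.2) p. 389 L25–29] [cite: BorelJacquet1979, §4.1] -/
theorem exists_archDetZPow (k : {v : InfinitePlace F // v.IsReal} → ℤ) :
    ∃ η : arch F E c N J →* ℂˣ,
      (∀ g, ((η g : ℂˣ) : ℂ) =
        ∏ v : {v : InfinitePlace F // v.IsReal},
          (((archAt F E c N J (wOf v) (hw v) hc g : archLocal E N J (wOf v)) : GL (Fin N) ℂ) :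
            Matrix (Fin N) (Fin N) ℂ).det ^ k v) ∧
      Continuous fun g => ((η g : ℂˣ) : ℂ) := by
  -- the homomorphism: product of `zpow (k v) ∘ det ∘ archAt (wOf v)`
  let d : {v : InfinitePlace F // v.IsReal} → (arch F E c N J →* ℂˣ) := fun v =>
    (zpowGroupHom (k v)).comp
      (Matrix.GeneralLinearGroup.det.comp
        ((archLocal E N J (wOf v)).subtype.comp (archAt F E c N J (wOf v) (hw v) hc)))
  have hd : ∀ v g, ((d v g : ℂˣ) : ℂ) =
      (((archAt F E c N J (wOf v) (hw v) hc g : archLocal E N J (wOf v)) : GL (Fin N) ℂ) :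
        Matrix (Fin N) (Fin N) ℂ).det ^ k v := by
    intro v g
    simp only [d, MonoidHom.coe_comp, Function.comp_apply, zpowGroupHom_apply, Subgroup.coe_subtype,
      Units.val_zpow_eq_zpow_val, Matrix.GeneralLinearGroup.val_det_apply]
  have hformula : ∀ g, (((∏ v, d v) g : ℂˣ) : ℂ) =
      ∏ v : {v : InfinitePlace F // v.IsReal},
        (((archAt F E c N J (wOf v) (hw v) hc g : archLocal E N J (wOf v)) : GL (Fin N) ℂ) :
          Matrix (Fin N) (Fin N) ℂ).det ^ k v := by
    intro g
    rw [MonoidHom.finsetProd_apply, Units.coe_prod]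
    exact Finset.prod_congr rfl fun v _ => hd v g
  refine ⟨∏ v, d v, hformula, ?_⟩
  -- continuity of the explicit formula
  have hcont : Continuous fun g : arch F E c N J =>
      ∏ v : {v : InfinitePlace F // v.IsReal},
        (((archAt F E c N J (wOf v) (hw v) hc g : archLocal E N J (wOf v)) : GL (Fin N) ℂ) :
          Matrix (Fin N) (Fin N) ℂ).det ^ k v := by
    refine continuous_finsetProd _ fun v _ => ?_
    have h1 : Continuous fun g : arch F E c N J =>
        (((archAt F E c N J (wOf v) (hw v) hc g : archLocal E N J (wOf v)) : GL (Fin N) ℂ) :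
          Matrix (Fin N) (Fin N) ℂ) :=
      Units.continuous_val.comp (continuous_subtype_val.comp (continuous_archAt F E c N J (wOf v) (hw v) hc))
    refine (h1.matrix_det).zpow₀ (k v) fun g => Or.inl ?_
    exact (Matrix.GeneralLinearGroup.det
      ((archAt F E c N J (wOf v) (hw v) hc g : archLocal E N J (wOf v)) : GL (Fin N) ℂ)).ne_zero
  exact hcont.congr fun g => (hformula g).symm

end DetPow

/-! ## § 4 The archimedean twist of a splitting character -/

section CM

variable (L : Type) [Field L] [NumberField L] [IsCMField L]

variable {N : ℕ} (J : Matrix (Fin N) (Fin N) L) (hc : IsCMField.complexConj L ≠ 1)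
  (wOf : {v : InfinitePlace (maximalRealSubfield L) // v.IsReal} → {w : InfinitePlace L // w.IsComplex})
  (hw : ∀ v, IsCMField.complexConj L • (wOf v).1 = (wOf v).1)
  (hover : ∀ v, (wOf v).1.comap (algebraMap (maximalRealSubfield L) L) = v.1)

/-- **Archimedean type of a splitting character is ODD.** A unitary Hecke character `χ` of the CM field `L` with
`χ|_{𝕀_{L⁺}} = ε_{L/L⁺}` has a unitary archimedean type `(e, 0)` — `χ((x,1)) = ∏_w (σ_w x_w/|σ_w x_w|)^{e_w}` — with
every `e_w` odd ([Liu2021, Remark 4.2]; tree `IsSplittingChar.exists_hasUnitaryArchType`). [cite: Liu2021, Remark 4.2] -/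
theorem _root_.Literature.RepresentationTheory.HarrisKudlaSweet1996.IsSplittingChar.exists_hasUnitaryArchType_odd
    {χ : HeckeCharacter L} (hχu : χ.IsUnitary) (hχ : IsSplittingChar L 1 χ) :
    ∃ e : InfinitePlace L → ℤ, χ.HasUnitaryArchType e 0 ∧ ∀ w, Odd (e w) := by
  obtain ⟨e, he, hmod⟩ := hχ.exists_hasUnitaryArchType hχu
  refine ⟨e, he, fun w => Int.odd_iff.2 ?_⟩
  have h := hmod w
  rw [Int.ModEq] at h
  simpa using h

include hover in
/-- **Square of a splitting character on the infinite ideles.** For `χ` unitary with `χ|_{𝕀_{L⁺}} = ε` of (odd) type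
`e` — `χ((x,1)) = ∏_w (σ_w x_w/|σ_w x_w|)^{e_w}`, the archimedean-parameter display of [Patrikis2019, §2.1] with
`t_w = 0` —: `χ((x,1))² = ∏_v (σ_w x_w / σ_w x_w‾)^{e_w}`, `w = wOf v`, for every infinite idele `x` of `L`
(`χ_w(z)² = (z/z̄)^{e_w}`). [cite: Patrikis2019, §2.1, display before Lemma 2.1.1] -/
theorem sq_apply_infiniteIdeles_eq_prod {χ : HeckeCharacter L} {e : InfinitePlace L → ℤ}
    (he : χ.HasUnitaryArchType e 0) (x : (InfiniteAdeleRing L)ˣ) :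
    ((χ (infiniteIdeles L x) : ℂˣ) : ℂ) ^ 2 =
      ∏ v : {v : InfinitePlace (maximalRealSubfield L) // v.IsReal},
        (Completion.extensionEmbedding (wOf v).1 ((x : InfiniteAdeleRing L) (wOf v).1) /
            conj (Completion.extensionEmbedding (wOf v).1 ((x : InfiniteAdeleRing L) (wOf v).1))) ^ e (wOf v).1 := by
  have hx : ∀ w : InfinitePlace L, Completion.extensionEmbedding w ((x : InfiniteAdeleRing L) w) ≠ 0 := by
    intro w
    refine (map_ne_zero (Completion.extensionEmbedding w)).2 ?_
    exact (Units.map (Pi.evalMonoidHom (fun w : InfinitePlace L => w.Completion) w) x).ne_zero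
  rw [he x, prod_infinitePlace_eq_prod_wOf L wOf hover, ← Finset.prod_pow]
  refine Finset.prod_congr rfl fun v _ => ?_
  simp only [Pi.zero_apply]
  exact archUnitaryValue_zero_right_sq _ (hx _)

include hover in
/-- **The archimedean twist of a splitting character** (archimedean input of the kernel construction of the
compatible splitting [GelbartRogawski1991, Prop. 3.1.1]).
Let `χ` be a unitary Hecke character of the CM field `L` with `χ|_{𝕀_{L⁺}} = ε_{L/L⁺}`.  Then there are an ODD tuple
`e = (e_w)_{w∣∞}` with `χ.HasUnitaryArchType e 0` (`χ_w(z) = (z/|z|)^{e_w}`) and a CONTINUOUS character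
`η : U(J)(L ⊗ ℝ) → ℂˣ`, `η(g) = ∏_v det(g_{wOf v})^{(e_{wOf v}+1)/2}`, such that for every `g ∈ U(J)(L ⊗ ℝ)` and every
infinite idele `x` of `L` with `σ_w(x_w)/σ_w(x_w)‾ = det g_w` at each `w = wOf v`:
`η(g)² · ∏_v det(g_{wOf v})⁻¹ = χ((x, 1))²`
(both sides equal `∏_v det(g_{wOf v})^{e_{wOf v}}`: `(u^k)² u⁻¹ = u^{2k−1}` and `χ_w(x_w)² = (x_w/x̄_w)^{e_w}`).
Printed sources of the two ingredients: the `det^{m/2}`-covers `{(g, z) ∣ z² = det(g)^{m}}` of the real unitary groups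
and their genuine `det`-power characters [Paul1998, §1.2 (1.2.1)–(1.2.2) p. 389] (here in the linear form
`(det^{(e+1)/2})² · det⁻¹ = det^{e}`, `e` odd), and the odd archimedean type of a splitting character
[Liu2021, Remark 4.2].  The identity itself is elementary; no statement of [GelbartRogawski1991] is asserted here — it is
an INPUT of the tree's kernel construction of the compatible splitting of Prop. 3.1.1 at the archimedean places.
[cite: Paul1998, §1.2 (1.2.1)–(1.2.2) p. 389 L11–29] [cite: Liu2021, Remark 4.2] -/
theorem _root_.Literature.RepresentationTheory.HarrisKudlaSweet1996.IsSplittingChar.exists_archDetTwist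
    {χ : HeckeCharacter L} (hχu : χ.IsUnitary) (hχ : IsSplittingChar L 1 χ) :
    ∃ (e : InfinitePlace L → ℤ) (η : arch (maximalRealSubfield L) L (IsCMField.complexConj L) N J →* ℂˣ),
      χ.HasUnitaryArchType e 0 ∧ (∀ w, Odd (e w)) ∧
      (∀ g, ((η g : ℂˣ) : ℂ) =
        ∏ v : {v : InfinitePlace (maximalRealSubfield L) // v.IsReal},
          (((archAt (maximalRealSubfield L) L (IsCMField.complexConj L) N J (wOf v) (hw v) hc g : archLocal L N J (wOf v)) :
              GL (Fin N) ℂ) : Matrix (Fin N) (Fin N) ℂ).det ^ ((e (wOf v).1 + 1) / 2)) ∧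
      (Continuous fun g => ((η g : ℂˣ) : ℂ)) ∧
      ∀ (g : arch (maximalRealSubfield L) L (IsCMField.complexConj L) N J) (x : (InfiniteAdeleRing L)ˣ),
        (∀ v : {v : InfinitePlace (maximalRealSubfield L) // v.IsReal},
          Completion.extensionEmbedding (wOf v).1 ((x : InfiniteAdeleRing L) (wOf v).1) /
              conj (Completion.extensionEmbedding (wOf v).1 ((x : InfiniteAdeleRing L) (wOf v).1)) =
            (((archAt (maximalRealSubfield L) L (IsCMField.complexConj L) N J (wOf v) (hw v) hc g : archLocal L N J (wOf v)) :
              GL (Fin N) ℂ) : Matrix (Fin N) (Fin N) ℂ).det) →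
        ((η g : ℂˣ) : ℂ) ^ 2 *
            ∏ v : {v : InfinitePlace (maximalRealSubfield L) // v.IsReal},
              ((((archAt (maximalRealSubfield L) L (IsCMField.complexConj L) N J (wOf v) (hw v) hc g : archLocal L N J (wOf v)) :
                GL (Fin N) ℂ) : Matrix (Fin N) (Fin N) ℂ).det)⁻¹ =
          ((χ (infiniteIdeles L x) : ℂˣ) : ℂ) ^ 2 := by
  obtain ⟨e, he, hodd⟩ := hχ.exists_hasUnitaryArchType_odd L hχu
  obtain ⟨η, hη, hηc⟩ := exists_archDetZPow (maximalRealSubfield L) L (IsCMField.complexConj L) N J hc wOf hw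
    fun v => (e (wOf v).1 + 1) / 2
  refine ⟨e, η, he, hodd, hη, hηc, fun g x hx => ?_⟩
  -- shorthand for the determinants
  set d : {v : InfinitePlace (maximalRealSubfield L) // v.IsReal} → ℂ := fun v =>
    (((archAt (maximalRealSubfield L) L (IsCMField.complexConj L) N J (wOf v) (hw v) hc g : archLocal L N J (wOf v)) :
      GL (Fin N) ℂ) : Matrix (Fin N) (Fin N) ℂ).det
  have hd0 : ∀ v, d v ≠ 0 := fun v =>
    (Matrix.GeneralLinearGroup.det
      ((archAt (maximalRealSubfield L) L (IsCMField.complexConj L) N J (wOf v) (hw v) hc g : archLocal L N J (wOf v)) : GL (Fin N) ℂ)).ne_zero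
  -- left side: `∏ (d^k)² · ∏ d⁻¹ = ∏ d^{2k-1} = ∏ d^e`
  rw [hη g, sq_apply_infiniteIdeles_eq_prod L wOf hover he x, ← Finset.prod_pow, ← Finset.prod_mul_distrib]
  refine Finset.prod_congr rfl fun v _ => ?_
  rw [hx v, zpow_sq_mul_inv (hd0 v), two_mul_add_one_ediv_two_sub_one (hodd _)]

end CM

end Literature.NumberTheory.GelbartRogawski1991.UnitaryDualPair.ArchSplitting

end
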